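import Summits.BirchSwinnertonDyer.BirchSwinnertonDyer.Theorems.ThetaPartnerAtTwoSignedKatoUpToAtTwoLayerPairingModDefs
import Literature.NumberTheory.GaloisRepresentations.ContinuousShapiroLiftPullback
import HarnessLib

/-!
# Route `ThetaPartnerAtTwo` (TP2), crux K3 `SignedKatoDivisibilityUpToAtTwo` (item stmt-BirchSwinnertonDyer-20308),
# line `colemanrat` v7 — (PT-orth) brick [S2-B2]: at `v ∣ p` (ONE ORBIT) the localisation of the GLOBAL Shapiro cup
# class `Sh^{Γ_ℚ}_{Γ_n} a ∪_{Σe} Sh^{Γ_ℚ}_{Γ_n} b ∈ H²(Γ_ℚ, μ_N)` IS the LAYER cup class of the (D-layer) pairing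

Width seat `bsd-wall-tp2-p2x-w3` g4 (cell `bsd-wall`), for lead tp2-p2x g5's S2 architecture of (PT-orth) (GLOBAL Shapiro
over `Γ_ℚ`, Tate reciprocity over `ℚ`, then the term at `v = p`). Theorems only; no `def`, no named fact, no `sorry`;
closes no item; BSD is NOT proved by any of this.

For the cyclotomic `ℤ_p`-extension `κ` of `ℚ`, a layer `Γ_n = κ.layerSubgroup n`, `v ∣ p`, `ι = closureEmb ℚ_v`,
`θ = resGalOfEmb ι : Γ_v → Γ_ℚ`, `U_n = layerGroup κ v n = θ⁻¹Γ_n`: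

* §1 ONE ORBIT: `θ(Γ_v)·Γ_n = Γ_ℚ` (`p` totally ramified in `ℚ_n`: `κ ∘ θ` is onto, the tree's
  `IsCyclotomic.exists_apply_resGalOfEmb_adicCompletion_eq`), so `θ̄ : Γ_v ⧸ U_n → Γ_ℚ ⧸ Γ_n` is bijective
  (`quotientPull_layerGroup_bijective`).
* §2 **`H¹(θ, ·∘θ̄) (Sh^{Γ_ℚ}_{Γ_n} a) = layerShapiro (layerLoc a)`** (`map_coindFinPull_shapiroLift_layer`, any representatives
  of `Γ_ℚ ⧸ Γ_n`; the tree's generic `map_coindFinPull_shapiroLift`), and for the Weil pairing `e` on `E[N]`: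
  **`loc_v (Sh a ∪_{Σ_{Γ_ℚ⧸Γ_n} e} Sh b) = layerShapiro (layerLoc a) ∪_{layerSumPairing} layerShapiro (layerLoc b)`** in
  `H²(Γ_v, μ_N|)` (`map_cupProduct_shapiroLift_layer`; `loc_v = H²(θ, id)`), hence
  **`inv_v (loc_v (Sh a ∪ Sh b)) = layerPairingMod … n a Q`** whenever `layerLoc b = layerKummer Q`
  (`invAt_map_cupProduct_shapiroLift_layer`) — the `v = p` term of Tate reciprocity for the global class `c_K` of S2 IS the
  (D-layer) pairing value `⟨a, Q⟩_{n,N}` of `…LayerPairingModDefs.lean` (and, through `layerPairingPk`/`exists_linear_layerPairing`,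
  the residue of the `ℤ_p`-linear layer pairing `pair n`).
* §3 **`layerKummer_eq_oneCocycleClass`**: a cocycle on `U_n` with values `ι_*(f τ) = τ • R − R`, `N • R = Q`, has class
  `layerKummer Q` — how the localisation of a finite-level Selmer cocycle is recognised as the (D-layer) Kummer class.

References: [NeukirchSchmidtWingberg2008] I §5 Prop. (1.5.3), I §6 (1.6.4)–(1.6.5); [Kobayashi2003] (8.23) (p. 18);
[MilneADT2006] I §6 (proof of Prop. 6.9: local terms of the Weil cup product); [Washington1997] §13.1.
-/

set_option autoImplicit false
-- the Theorems namespace of this sub repeats the summit name by design (D-0017 nested layout)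
set_option linter.dupNamespace false

noncomputable section

open scoped Classical

namespace Summit.BirchSwinnertonDyer.BirchSwinnertonDyer.Theorems

namespace SignedKatoOffTwo.LayerPairing

open CategoryTheory Field NumberField IsDedekindDomain WeierstrassCurve
  Literature.NumberTheory.EllipticCurves Literature.NumberTheory.GaloisRepresentations
  Literature.NumberTheory.EllipticCurves.Kobayashi2003 Literature.NumberTheory.EllipticCurves.Sprung2012
  Literature.NumberTheory.GaloisCohomology ZpExtension

-- Cup products need `LocallyCompactSpace Γ`; as in `…LayerPairingModDefs.lean` the compactness of absolute Galois groups is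
-- a local instance only.
attribute [local instance] absoluteGaloisGroup_compactSpace

variable (W : WeierstrassCurve ℚ) [W.IsElliptic] (N : ℕ) [NeZero N]
  (e : geomTorsion W N → geomTorsion W N → AlgebraicClosure ℚ)
  (hμ : ∀ S T, e S T ^ N = 1)
  (hadd₁ : ∀ S₁ S₂ T, e (S₁ + S₂) T = e S₁ T * e S₂ T)
  (hadd₂ : ∀ S T₁ T₂, e S (T₁ + T₂) = e S T₁ * e S T₂)
  (hgal : ∀ (σ : absoluteGaloisGroup ℚ) (S T : geomTorsion W N), σ • e S T = e (σ • S) (σ • T))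
  {p : ℕ} [Fact p.Prime] (κ : ZpExtension ℚ p) (v : HeightOneSpectrum (𝓞 ℚ))

attribute [local instance] finite_geomTorsion_of_neZero

/-! ## §1 One orbit at `v ∣ p` -/

/-- **`θ(Γ_v)·Γ_n = Γ_ℚ` for the cyclotomic tower at `v ∣ p`**: every `g ∈ Γ_ℚ` is `θ(d)·u` with `d ∈ Γ_v`, `u ∈ Γ_n`
(`κ ∘ θ : Γ_v → ℤ_p` is onto — `p` is totally ramified in `ℚ_∞` — and `ker κ ≤ Γ_n`). [cite: Washington1997, §13.1]
[cite: Kobayashi2003, §2 (p. 4)] -/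
theorem forall_exists_inv_mul_mem_layerSubgroup (hκ : κ.IsCyclotomic) (hv : (p : 𝓞 ℚ) ∈ v.asIdeal) (n : ℕ) :
    ∀ g : absoluteGaloisGroup ℚ, ∃ d : absoluteGaloisGroup (v.adicCompletion ℚ),
      (resGalOfEmb (closureEmb (K := ℚ) (v.adicCompletion ℚ)) d)⁻¹ * g ∈ κ.layerSubgroup n := fun g => by
  obtain ⟨d, hd⟩ := hκ.exists_apply_resGalOfEmb_adicCompletion_eq v hv (κ g)
  exact ⟨d, κ.kerSubgroup_le_layerSubgroup n (by rw [mem_kerSubgroup, map_mul, map_inv, hd, inv_mul_cancel])⟩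

/-- **`θ̄ : Γ_v ⧸ U_n → Γ_ℚ ⧸ Γ_n` is bijective** at `v ∣ p` for the cyclotomic tower (`U_n = θ⁻¹Γ_n` and one orbit).
[cite: Washington1997, §13.1] [cite: NeukirchSchmidtWingberg2008, I §6 (1.6.5)] -/
theorem quotientPull_layerGroup_bijective (hκ : κ.IsCyclotomic) (hv : (p : 𝓞 ℚ) ∈ v.asIdeal) (n : ℕ) :
    Function.Bijective (quotientPull (κ.layerSubgroup n) (resGalOfEmb (closureEmb (K := ℚ) (v.adicCompletion ℚ)))
      (layerGroup κ v n) (fun _ h => h)) :=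
  ⟨quotientPull_injective _ _ _ _ (fun _ h => h),
    quotientPull_surjective _ _ _ _ (forall_exists_inv_mul_mem_layerSubgroup κ v hκ hv n)⟩

/-! ## §2 Localisation of the global Shapiro cup class at `v ∣ p` -/

variable (hκ : κ.IsCyclotomic) (hv : (p : 𝓞 ℚ) ∈ v.asIdeal)

include hκ hv in
omit [W.IsElliptic] [NeZero N] in
/-- **`H¹(θ, ·∘θ̄) (Sh^{Γ_ℚ}_{Γ_n} a) = layerShapiro (layerLoc a)`**: restricting the GLOBAL Shapiro lift of
`a ∈ H¹(Γ_n, E[N])` to `Γ_v` along `θ` (coefficients `Maps(Γ_ℚ ⧸ Γ_n, E[N]) → Maps(Γ_v ⧸ U_n, E[N]|)`, `φ ↦ φ ∘ θ̄`) gives the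
LAYER Shapiro lift of its localisation, for any representatives of `Γ_ℚ ⧸ Γ_n` (one orbit at `v ∣ p`).
[cite: NeukirchSchmidtWingberg2008, I §6 Prop. (1.6.4), (1.6.5)] [cite: Kobayashi2003, (8.23) (p. 18)] -/
theorem map_coindFinPull_shapiroLift_layer (n : ℕ) {s : absoluteGaloisGroup ℚ ⧸ κ.layerSubgroup n → absoluteGaloisGroup ℚ}
    (hs : ∀ y, (s y : absoluteGaloisGroup ℚ ⧸ κ.layerSubgroup n) = y)
    (hs1 : s ((1 : absoluteGaloisGroup ℚ) : absoluteGaloisGroup ℚ ⧸ κ.layerSubgroup n) = 1)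
    (a : H1 (W.torsionGaloisModule (N : ℤ)) (κ.layerSubgroup n)) :
    ContinuousCohomology.map (resGalOfEmb (closureEmb (K := ℚ) (v.adicCompletion ℚ)))
        (coindFinPull (W.torsionGaloisModule (N : ℤ)).toTopRep (κ.layerSubgroup n)
          (resGalOfEmb (closureEmb (K := ℚ) (v.adicCompletion ℚ))) (X' := torsionLocalRep W N v)
          (TopRep.ofHom ⟨ContinuousLinearMap.id ℤ (geomTorsion W N), fun _ => rfl⟩) (layerGroup κ v n) (fun _ h => h)) 1
        (shapiroLift (W.torsionGaloisModule (N : ℤ)).toTopRep (κ.layerSubgroup n) (κ.isOpen_layerSubgroup n) hs hs1 a) =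
      layerShapiro W N κ v n (layerLoc W N κ v n a) :=
  map_coindFinPull_shapiroLift (W.torsionGaloisModule (N : ℤ)).toTopRep (κ.layerSubgroup n)
    (resGalOfEmb (closureEmb (K := ℚ) (v.adicCompletion ℚ))) (X' := torsionLocalRep W N v)
    (TopRep.ofHom ⟨ContinuousLinearMap.id ℤ (geomTorsion W N), fun _ => rfl⟩) (layerGroup κ v n) (fun _ h => h)
    (resGalSubgroupOfEmb (κ.layerSubgroup n) (closureEmb (K := ℚ) (v.adicCompletion ℚ))) (fun _ => rfl)
    (κ.isOpen_layerSubgroup n) (isOpen_layerGroup κ v n) hs hs1 (layerReps_spec κ v n) (layerReps_one κ v n)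
    (quotientPull_layerGroup_bijective κ v hκ hv n) a

include hκ hv in
omit [W.IsElliptic] in
/-- **`loc_v (Sh a ∪_{Σe} Sh b) = layerShapiro (layerLoc a) ∪_{layerSumPairing} layerShapiro (layerLoc b)`** in `H²(Γ_v, μ_N|)`:
at `v ∣ p` the localisation (`H²(θ, id)`, `θ = resGalOfEmb ι`) of the cup product of two GLOBAL Shapiro lifts for the
fibre-sum Weil pairing `Σ_{Γ_ℚ⧸Γ_n} e` (the class `c_K` of the lead's S2) is the LAYER cup class of the (D-layer), for any
representatives and any `Fintype (Γ_ℚ ⧸ Γ_n)`. [cite: NeukirchSchmidtWingberg2008, I §5 Prop. (1.5.3), I §6 (1.6.5)]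
[cite: MilneADT2006, Ch. I §6, proof of Prop. 6.9] -/
theorem map_cupProduct_shapiroLift_layer (n : ℕ) [Fintype (absoluteGaloisGroup ℚ ⧸ κ.layerSubgroup n)]
    {s : absoluteGaloisGroup ℚ ⧸ κ.layerSubgroup n → absoluteGaloisGroup ℚ}
    (hs : ∀ y, (s y : absoluteGaloisGroup ℚ ⧸ κ.layerSubgroup n) = y)
    (hs1 : s ((1 : absoluteGaloisGroup ℚ) : absoluteGaloisGroup ℚ ⧸ κ.layerSubgroup n) = 1)
    (a b : H1 (W.torsionGaloisModule (N : ℤ)) (κ.layerSubgroup n)) :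
    ContinuousCohomology.map (resGalOfEmb (closureEmb (K := ℚ) (v.adicCompletion ℚ)))
        (X := (DiscreteGaloisModule.mu ℚ N).toTopRep) (Y := muLocalRep N v)
        (TopRep.ofHom ⟨ContinuousLinearMap.id ℤ (DiscreteGaloisModule.MuCarrier ℚ N), fun _ => rfl⟩) 2
        (((weilContPairing W N e hμ hadd₁ hadd₂ hgal).coindFin (κ.layerSubgroup n)).cupProduct
          (shapiroLift (W.torsionGaloisModule (N : ℤ)).toTopRep (κ.layerSubgroup n) (κ.isOpen_layerSubgroup n) hs hs1 a)
          (shapiroLift (W.torsionGaloisModule (N : ℤ)).toTopRep (κ.layerSubgroup n) (κ.isOpen_layerSubgroup n) hs hs1 b)) =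
      (layerSumPairing W N e hμ hadd₁ hadd₂ hgal κ v n).cupProduct
        (layerShapiro W N κ v n (layerLoc W N κ v n a)) (layerShapiro W N κ v n (layerLoc W N κ v n b)) := by
  letI : Fintype (absoluteGaloisGroup (v.adicCompletion ℚ) ⧸ layerGroup κ v n) := layerFintypeQuot κ v n
  rw [← map_coindFinPull_shapiroLift_layer W N κ v hκ hv n hs hs1 a,
    ← map_coindFinPull_shapiroLift_layer W N κ v hκ hv n hs hs1 b]
  exact ContPairing.map_cupProduct_coindFin_pull (weilContPairing W N e hμ hadd₁ hadd₂ hgal) (κ.layerSubgroup n)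
    (resGalOfEmb (closureEmb (K := ℚ) (v.adicCompletion ℚ))) (weilLocalPairing W N e hμ hadd₁ hadd₂ hgal v)
    (TopRep.ofHom ⟨ContinuousLinearMap.id ℤ (geomTorsion W N), fun _ => rfl⟩)
    (TopRep.ofHom ⟨ContinuousLinearMap.id ℤ (geomTorsion W N), fun _ => rfl⟩)
    (TopRep.ofHom ⟨ContinuousLinearMap.id ℤ (DiscreteGaloisModule.MuCarrier ℚ N), fun _ => rfl⟩)
    (fun _ _ => rfl) (layerGroup κ v n) (fun _ h => h) (quotientPull_layerGroup_bijective κ v hκ hv n) _ _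

include hκ hv in
/-- **`inv_v (loc_v (Sh a ∪_{Σe} Sh b)) = ⟨a, Q⟩_{n,N}`** — the `v = p` local term of Tate reciprocity for the global
Shapiro cup class IS the (D-layer) layer pairing value `layerPairingMod … n a Q`, as soon as the localisation of `b` at the
layer is the layer Kummer class of `Q ∈ E(ℚ_{n,v})` (`layerLoc b = layerKummer Q`).
[cite: Kobayashi2003, (8.23) (p. 18)] [cite: MilneADT2006, Ch. I §6, proof of Prop. 6.9] -/
theorem invAt_map_cupProduct_shapiroLift_layer (n : ℕ) [Fintype (absoluteGaloisGroup ℚ ⧸ κ.layerSubgroup n)]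
    {s : absoluteGaloisGroup ℚ ⧸ κ.layerSubgroup n → absoluteGaloisGroup ℚ}
    (hs : ∀ y, (s y : absoluteGaloisGroup ℚ ⧸ κ.layerSubgroup n) = y)
    (hs1 : s ((1 : absoluteGaloisGroup ℚ) : absoluteGaloisGroup ℚ ⧸ κ.layerSubgroup n) = 1)
    (a b : H1 (W.torsionGaloisModule (N : ℤ)) (κ.layerSubgroup n))
    (Q : localLayerPointsOfEmb κ (closureEmb (K := ℚ) (v.adicCompletion ℚ)) W n)
    (hb : layerLoc W N κ v n b = layerKummer W N κ v n Q) :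
    invAt N v (ContinuousCohomology.map (resGalOfEmb (closureEmb (K := ℚ) (v.adicCompletion ℚ)))
        (X := (DiscreteGaloisModule.mu ℚ N).toTopRep) (Y := muLocalRep N v)
        (TopRep.ofHom ⟨ContinuousLinearMap.id ℤ (DiscreteGaloisModule.MuCarrier ℚ N), fun _ => rfl⟩) 2
        (((weilContPairing W N e hμ hadd₁ hadd₂ hgal).coindFin (κ.layerSubgroup n)).cupProduct
          (shapiroLift (W.torsionGaloisModule (N : ℤ)).toTopRep (κ.layerSubgroup n) (κ.isOpen_layerSubgroup n) hs hs1 a)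
          (shapiroLift (W.torsionGaloisModule (N : ℤ)).toTopRep (κ.layerSubgroup n) (κ.isOpen_layerSubgroup n) hs hs1 b))) =
      layerPairingMod W N e hμ hadd₁ hadd₂ hgal κ v n a Q := by
  rw [map_cupProduct_shapiroLift_layer W N e hμ hadd₁ hadd₂ hgal κ v hκ hv n hs hs1 a b, hb, layerPairingMod_apply]

include hκ hv in
/-- The same with the tree's `galoisCohomology.localization (mu ℚ N) (Sum.inr v) 2` for `loc_v` (the spelling of the
Poitou–Tate / Tate-reciprocity files; definitionally `H²(resGalOfEmb ι, id)`). [cite: Kobayashi2003, (8.23) (p. 18)]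
[cite: MilneADT2006, Ch. I §6, proof of Prop. 6.9] -/
theorem invAt_localization_cupProduct_shapiroLift_layer (n : ℕ) [Fintype (absoluteGaloisGroup ℚ ⧸ κ.layerSubgroup n)]
    {s : absoluteGaloisGroup ℚ ⧸ κ.layerSubgroup n → absoluteGaloisGroup ℚ}
    (hs : ∀ y, (s y : absoluteGaloisGroup ℚ ⧸ κ.layerSubgroup n) = y)
    (hs1 : s ((1 : absoluteGaloisGroup ℚ) : absoluteGaloisGroup ℚ ⧸ κ.layerSubgroup n) = 1)
    (a b : H1 (W.torsionGaloisModule (N : ℤ)) (κ.layerSubgroup n))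
    (Q : localLayerPointsOfEmb κ (closureEmb (K := ℚ) (v.adicCompletion ℚ)) W n)
    (hb : layerLoc W N κ v n b = layerKummer W N κ v n Q) :
    invAt N v (galoisCohomology.localization (DiscreteGaloisModule.mu ℚ N) (Sum.inr v) 2
        (((weilContPairing W N e hμ hadd₁ hadd₂ hgal).coindFin (κ.layerSubgroup n)).cupProduct
          (shapiroLift (W.torsionGaloisModule (N : ℤ)).toTopRep (κ.layerSubgroup n) (κ.isOpen_layerSubgroup n) hs hs1 a)
          (shapiroLift (W.torsionGaloisModule (N : ℤ)).toTopRep (κ.layerSubgroup n) (κ.isOpen_layerSubgroup n) hs hs1 b))) =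
      layerPairingMod W N e hμ hadd₁ hadd₂ hgal κ v n a Q :=
  invAt_map_cupProduct_shapiroLift_layer W N e hμ hadd₁ hadd₂ hgal κ v hκ hv n hs hs1 a b Q hb


/-! ## §3 Recognising the layer Kummer class from the values of a cocycle -/

/-- **A cocycle with the Kummer values IS the layer Kummer class**: if `f ∈ Z¹(U_n, E[N]|)` satisfies
`ι_*(f τ) = τ • R − R` (`τ ∈ U_n`) for a root `R ∈ E(ℚ̄_v)` of `Q ∈ E(ℚ_{n,v})` (`N • R = Q`), then `layerKummer Q = [f]`
(`layerKummer` does not depend on the root: `subgroupKummerMap_apply_eq`). This is the form in which the localisation at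
`v ∣ p` of a finite-level lift of a Selmer cocycle (lead's `…LayerKummerWitness.lean`: values `τ • R − R` pointwise) is
recognised as the (D-layer) Kummer class, i.e. the hypothesis `layerLoc b = layerKummer Q` of
`invAt_localization_cupProduct_shapiroLift_layer`. [cite: SilvermanAEC2009, VIII §2 (pp. 190–191)] [cite: Kobayashi2003, (8.23) (p. 18)] -/
theorem layerKummer_eq_oneCocycleClass (n : ℕ)
    (Q : localLayerPointsOfEmb κ (closureEmb (K := ℚ) (v.adicCompletion ℚ)) W n) (R : localPoints W (v.adicCompletion ℚ))
    (hR : (N : ℤ) • R = Q) (f : contOneCocycles (subgroupRep (torsionLocalRep W N v) (layerGroup κ v n)))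
    (hf : ∀ τ : layerGroup κ v n,
      pointsMapOfEmb W (closureEmb (K := ℚ) (v.adicCompletion ℚ)) ((f.1 τ : geomTorsion W N) : geomPoints W) =
        (τ : absoluteGaloisGroup (v.adicCompletion ℚ)) • R - R) :
    layerKummer W N κ v n Q = oneCocycleClass _ f := by
  have hN : (N : ℤ) ≠ 0 := by exact_mod_cast NeZero.ne N
  have hfix : (N : ℤ) • R ∈ FixedPoints.addSubgroup (layerGroup κ v n) (localPoints W (v.adicCompletion ℚ)) := by
    rw [hR]; exact Q.2
  change W.subgroupKummerMap (N : ℤ) (layerGroup κ v n) hN Q = _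
  rw [W.subgroupKummerMap_apply_eq _ (layerGroup κ v n) hN Q R hfix hR]
  unfold WeierstrassCurve.subgroupKummerClass
  congr 1
  apply Subtype.ext
  ext τ
  apply pointsMapOfEmb_injective W (closureEmb (K := ℚ) (v.adicCompletion ℚ))
  rw [hf]
  exact W.pointsMap_subgroupKummerCocycle_apply _ _ hN R hfix τ

end SignedKatoOffTwo.LayerPairing

end Summit.BirchSwinnertonDyer.BirchSwinnertonDyer.Theorems

end
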